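import Literature.Probability.Percolation.KozmaNitzanPreFKG
import HarnessLib

/-!
# Kozma–Nitzan's Lemma 3 with TWO-SIDED conditioning (conditional association, BHK 2006 Thm. 1.5)

Crux `PercNearOneGluingNoHeavy.NoHeavyLowerTail` (stmt-CriticalPhenomena-4575), lemma factory #7 (conditional
association), helper file (`--supports`).

Kozma–Nitzan (arXiv:2401.12397, Lemma 3) transfer a comparison `P(a₁ ↔ b) ≤ P(a₂ ↔ b) + δ` to
`P(a₁ ↔ b, Q) ≤ P(a₂ ↔ b, Q) + δ` for an event `Q` which is EITHER increasing in the cluster of `a₂` (part (i))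
OR decreasing in the cluster of `a₁` (part (ii)); both parts are in the tree (`KozmaNitzan2024_lemma3_i/_ii`).
Here the two parts are merged: the same conclusion holds for every event `Q = {(C_{a₂}, C_{a₁}) ∈ 𝒬}` read off the
PAIR of open edge clusters through a family `𝒬` that is increasing in the first and decreasing in the second
coordinate (an upper family of `Set (Sym2 V) × (Set (Sym2 V))ᵒᵈ`), e.g. `Q = {a₂ ↔ z₁} ∩ {a₁ ↮ z₂}`.  The proof is the printed one with
van den Berg–Häggström–Kahn's Theorem 1.5 (joint positive association, given `{a₂ ↮ a₁}`, of the functions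
increasing in `C_{a₂}` and decreasing in `C_{a₁}`; tree fact `BHK2006_twoClusterConditionalAssociation`, PROVED in
`TwoClusterConditionalAssociationProofs`) used for BOTH correlation steps: on `D = {a₁ ↮ a₂}`,
`μ(D) μ(D, a₁↔b, Q) ≤ μ(D, a₁↔b) μ(D, Q)` (`1{a₁ ↔ b}` is increasing in `C_{a₁}`, hence negatively correlated
with `1_Q`) and `μ(D, a₂↔b) μ(D, Q) ≤ μ(D) μ(D, a₂↔b, Q)` (`1{a₂ ↔ b}` is increasing in `C_{a₂}`); off `D` the
two connection events coincide.

These "conditioned minimality rows" are the conditional-association ingredient of the law-level certificates for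
the two-lonely-children gluing kernel (prim-lf-7 gen 7, CANDIDATES.md batch 14): with `a₁ = a₀` the
`H`-loneliest relay and `a₂ = r` any other relay, every such `Q` gives a linear constraint
`P_H(a₀ ↔ b, Q) ≤ P_H(r ↔ b, Q)` on the terminal partition law of the relay graph.

Contents: the two correlation inequalities
`JointLemma3.pos_corr_left` / `JointLemma3.neg_corr_right`, and `JointLemma3.lemma3_joint` (with the `δ = 0`
corollary `lemma3_joint₀` and the basic instance `lemma3_conn_notConn` for `Q = {a₂ ↔ z₁} ∩ {a₁ ↮ z₂}`).
-/

noncomputable section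

namespace Summit.CriticalPhenomena.PercolationContinuityZ3.Theorems

namespace JointLemma3

open MeasureTheory Set
open Literature.Probability.Percolation Literature.Probability.Percolation.KNPreFKG
open Literature.Probability.LatticeModels (prodBernoulli)

variable {V : Type*}

/-! An event "increasing in `C_s` and decreasing in `C_t`" (BHK 2006 Thm. 1.5) is rendered by an UPPER family
`𝒬 ⊆ Set (Sym2 V) × (Set (Sym2 V))ᵒᵈ` for the product order (inclusion on the first factor, reversed inclusion on
the second): `(C, D) ≤ (C', D')` iff `C ⊆ C'` and `D' ⊆ D`. -/

/-- The indicator of `𝒬` is increasing in the first variable. [folklore] -/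
theorem ind₂_mono_left {𝒬 : Set (Set (Sym2 V) × (Set (Sym2 V))ᵒᵈ)} (h𝒬 : IsUpperSet 𝒬) (D : Set (Sym2 V)) :
    Monotone fun C => (𝒬.indicator (1 : Set (Sym2 V) × (Set (Sym2 V))ᵒᵈ → ℝ)) (C, OrderDual.toDual D) := by
  intro C C' hCC'
  simp only []
  have hle : (C, OrderDual.toDual D) ≤ (C', OrderDual.toDual D) := ⟨hCC', le_rfl⟩
  by_cases h : (C, OrderDual.toDual D) ∈ 𝒬
  · rw [indicator_of_mem h, indicator_of_mem (h𝒬 hle h), Pi.one_apply, Pi.one_apply]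
  · rw [indicator_of_notMem h]
    exact indicator_nonneg (fun _ _ => zero_le_one) _

/-- The indicator of `𝒬` is decreasing in the second variable. [folklore] -/
theorem ind₂_anti_right {𝒬 : Set (Set (Sym2 V) × (Set (Sym2 V))ᵒᵈ)} (h𝒬 : IsUpperSet 𝒬) (C : Set (Sym2 V)) :
    Antitone fun D => (𝒬.indicator (1 : Set (Sym2 V) × (Set (Sym2 V))ᵒᵈ → ℝ)) (C, OrderDual.toDual D) := by
  intro D D' hDD'
  simp only []
  have hle : (C, OrderDual.toDual D') ≤ (C, OrderDual.toDual D) := ⟨le_rfl, OrderDual.toDual_le_toDual.2 hDD'⟩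
  by_cases h : (C, OrderDual.toDual D') ∈ 𝒬
  · rw [indicator_of_mem h, indicator_of_mem (h𝒬 hle h), Pi.one_apply, Pi.one_apply]
  · rw [indicator_of_notMem h]
    exact indicator_nonneg (fun _ _ => zero_le_one) _

/-- The indicator of `𝒬` at `(C_s ω, C_t ω)` is the indicator of the event `{(C_s, C_t) ∈ 𝒬}`. [folklore] -/
theorem ind₂_openEdgeCluster (s t : V) (𝒬 : Set (Set (Sym2 V) × (Set (Sym2 V))ᵒᵈ)) :
    (fun ω : BondConfig V => (𝒬.indicator (1 : Set (Sym2 V) × (Set (Sym2 V))ᵒᵈ → ℝ)) ((openEdgeCluster ω s), OrderDual.toDual (openEdgeCluster ω t))) =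
      ({ω : BondConfig V | (openEdgeCluster ω s, OrderDual.toDual (openEdgeCluster ω t)) ∈ 𝒬}).indicator 1 := by
  funext ω
  by_cases h : (openEdgeCluster ω s, OrderDual.toDual (openEdgeCluster ω t)) ∈ 𝒬
  · rw [indicator_of_mem h, indicator_of_mem
      (show ω ∈ {ω | (openEdgeCluster ω s, OrderDual.toDual (openEdgeCluster ω t)) ∈ 𝒬} from h)]
    rfl
  · rw [indicator_of_notMem h, indicator_of_notMem
      (show ω ∉ {ω | (openEdgeCluster ω s, OrderDual.toDual (openEdgeCluster ω t)) ∈ 𝒬} from h)]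

variable [Fintype V]

/-- **BHK Thm. 1.5, event form, joint event × increasing event of `C_s`.**  For `s ≠ t`, `D = {s ↮ t}`, `𝒜` an
upper family read on `C_s` and `Q = {(C_s, C_t) ∈ 𝒬}` with `𝒬` an upper family of `Set (Sym2 V) × (Set (Sym2 V))ᵒᵈ`:
`μ(D ∩ {C_s ∈ 𝒜}) · μ(D ∩ Q) ≤ μ(D) · μ(D ∩ ({C_s ∈ 𝒜} ∩ Q))` (positive correlation given `D`).
[cite: VandenbergHaggstromKahn2005, Thm. 1.5 (p. 7, eq. (9))] -/
theorem pos_corr_left (w : Sym2 V → unitInterval) (s t : V) (hst : s ≠ t)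
    {𝒜 : Set (Set (Sym2 V))} (h𝒜 : IsUpperSet 𝒜)
    {𝒬 : Set (Set (Sym2 V) × (Set (Sym2 V))ᵒᵈ)} (h𝒬 : IsUpperSet 𝒬) :
    (prodBernoulli w).real ({ω : BondConfig V | ¬ (openGraph ω).Reachable s t} ∩
        {ω | openEdgeCluster ω s ∈ 𝒜}) *
      (prodBernoulli w).real ({ω : BondConfig V | ¬ (openGraph ω).Reachable s t} ∩ {ω : BondConfig V | (openEdgeCluster ω s, OrderDual.toDual (openEdgeCluster ω t)) ∈ 𝒬}) ≤
    (prodBernoulli w).real {ω : BondConfig V | ¬ (openGraph ω).Reachable s t} *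
      (prodBernoulli w).real ({ω : BondConfig V | ¬ (openGraph ω).Reachable s t} ∩
        ({ω | openEdgeCluster ω s ∈ 𝒜} ∩ {ω : BondConfig V | (openEdgeCluster ω s, OrderDual.toDual (openEdgeCluster ω t)) ∈ 𝒬})) := by
  have key := BHK2006_twoClusterConditionalAssociation_holds V w s t
    (fun C _ => 𝒜.indicator (1 : Set (Sym2 V) → ℝ) C) (fun C D => (𝒬.indicator (1 : Set (Sym2 V) × (Set (Sym2 V))ᵒᵈ → ℝ)) (C, OrderDual.toDual D))
    (fun _ => monotone_indicator_one_of_isUpperSet h𝒜) (fun _ => antitone_const)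
    (fun D => ind₂_mono_left h𝒬 D) (fun C => ind₂_anti_right h𝒬 C) hst
  rw [show (fun ω : BondConfig V => 𝒜.indicator (1 : Set (Sym2 V) → ℝ) (openEdgeCluster ω s) *
      (𝒬.indicator (1 : Set (Sym2 V) × (Set (Sym2 V))ᵒᵈ → ℝ)) ((openEdgeCluster ω s), OrderDual.toDual (openEdgeCluster ω t))) =
      ({ω : BondConfig V | openEdgeCluster ω s ∈ 𝒜} ∩ {ω : BondConfig V | (openEdgeCluster ω s, OrderDual.toDual (openEdgeCluster ω t)) ∈ 𝒬}).indicator 1 by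
    rw [← indicator_one_mul_indicator_one]
    funext ω
    rw [← indicator_comp_openEdgeCluster, ← ind₂_openEdgeCluster],
    indicator_comp_openEdgeCluster, ind₂_openEdgeCluster,
    setIntegral_indicator_one_eq, setIntegral_indicator_one_eq, setIntegral_indicator_one_eq] at key
  exact key

/-- **BHK Thm. 1.5, event form, joint event × increasing event of `C_t`.**  For `s ≠ t`, `D = {s ↮ t}`, `ℬ` an
upper family read on `C_t` and `Q = {(C_s, C_t) ∈ 𝒬}` with `𝒬` an upper family of `Set (Sym2 V) × (Set (Sym2 V))ᵒᵈ`: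
`μ(D) · μ(D ∩ ({C_t ∈ ℬ} ∩ Q)) ≤ μ(D ∩ {C_t ∈ ℬ}) · μ(D ∩ Q)` (negative correlation given `D`; Thm. 1.5
applied to `1_Q` and `-1_{ℬ}(C_t)`). [cite: VandenbergHaggstromKahn2005, Thm. 1.5 (p. 7, eq. (9))] -/
theorem neg_corr_right (w : Sym2 V → unitInterval) (s t : V) (hst : s ≠ t)
    {ℬ : Set (Set (Sym2 V))} (hℬ : IsUpperSet ℬ)
    {𝒬 : Set (Set (Sym2 V) × (Set (Sym2 V))ᵒᵈ)} (h𝒬 : IsUpperSet 𝒬) :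
    (prodBernoulli w).real {ω : BondConfig V | ¬ (openGraph ω).Reachable s t} *
      (prodBernoulli w).real ({ω : BondConfig V | ¬ (openGraph ω).Reachable s t} ∩
        ({ω | openEdgeCluster ω t ∈ ℬ} ∩ {ω : BondConfig V | (openEdgeCluster ω s, OrderDual.toDual (openEdgeCluster ω t)) ∈ 𝒬})) ≤
    (prodBernoulli w).real ({ω : BondConfig V | ¬ (openGraph ω).Reachable s t} ∩
        {ω | openEdgeCluster ω t ∈ ℬ}) *
      (prodBernoulli w).real ({ω : BondConfig V | ¬ (openGraph ω).Reachable s t} ∩ {ω : BondConfig V | (openEdgeCluster ω s, OrderDual.toDual (openEdgeCluster ω t)) ∈ 𝒬}) := by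
  have key := BHK2006_twoClusterConditionalAssociation_holds V w s t
    (fun C D => (𝒬.indicator (1 : Set (Sym2 V) × (Set (Sym2 V))ᵒᵈ → ℝ)) (C, OrderDual.toDual D)) (fun _ D => -ℬ.indicator (1 : Set (Sym2 V) → ℝ) D)
    (fun D => ind₂_mono_left h𝒬 D) (fun C => ind₂_anti_right h𝒬 C)
    (fun _ => monotone_const) (fun _ _ _ hDD' => neg_le_neg (monotone_indicator_one_of_isUpperSet hℬ hDD')) hst
  have h1 : (fun ω : BondConfig V => (𝒬.indicator (1 : Set (Sym2 V) × (Set (Sym2 V))ᵒᵈ → ℝ)) ((openEdgeCluster ω s), OrderDual.toDual (openEdgeCluster ω t)) *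
      -ℬ.indicator (1 : Set (Sym2 V) → ℝ) (openEdgeCluster ω t)) =
      fun ω => -(({ω : BondConfig V | openEdgeCluster ω t ∈ ℬ} ∩ {ω : BondConfig V | (openEdgeCluster ω s, OrderDual.toDual (openEdgeCluster ω t)) ∈ 𝒬}).indicator
        (1 : BondConfig V → ℝ) ω) := by
    funext ω
    have e1 := congrFun (ind₂_openEdgeCluster s t 𝒬) ω
    have e2 := congrFun (indicator_comp_openEdgeCluster ℬ t) ω
    have e3 := congrFun (indicator_one_mul_indicator_one ({ω : BondConfig V | openEdgeCluster ω t ∈ ℬ})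
      ({ω : BondConfig V | (openEdgeCluster ω s, OrderDual.toDual (openEdgeCluster ω t)) ∈ 𝒬})) ω
    rw [e1, e2, ← e3]
    ring
  have h2 : (fun ω : BondConfig V => -ℬ.indicator (1 : Set (Sym2 V) → ℝ) (openEdgeCluster ω t)) =
      fun ω => -({ω : BondConfig V | openEdgeCluster ω t ∈ ℬ}.indicator (1 : BondConfig V → ℝ) ω) := by
    funext ω
    rw [← indicator_comp_openEdgeCluster]
  rw [h1, h2, ind₂_openEdgeCluster, integral_neg, integral_neg, setIntegral_indicator_one_eq,
    setIntegral_indicator_one_eq, setIntegral_indicator_one_eq] at key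
  linarith

/-- **Kozma–Nitzan's Lemma 3, parts (i) and (ii) jointly.**  If `μ(a₁ ↔ b) ≤ μ(a₂ ↔ b) + δ` (`δ ≥ 0`) then for
every event `Q = {(C_{a₂}, C_{a₁}) ∈ 𝒬}` with `𝒬` increasing in the first (the cluster of `a₂`) and decreasing in
the second coordinate (the cluster of `a₁`):  `μ(a₁ ↔ b, Q) ≤ μ(a₂ ↔ b, Q) + δ`.
(`𝒬` depending only on the first coordinate: Lemma 3(i); only on the second: Lemma 3(ii).)
Proof as printed for Lemma 3, with BHK Thm. 1.5 for both correlation steps on `D = {a₁ ↮ a₂}`.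
[cite: KozmaNitzan2024, Lemma 3 (pp. 6–7)] [cite: VandenbergHaggstromKahn2005, Thm. 1.5 (p. 7)] -/
theorem lemma3_joint (w : Sym2 V → unitInterval) (a₁ a₂ b : V) {δ : ℝ} (hδ : 0 ≤ δ)
    (h : (prodBernoulli w).real (openConn a₁ b) ≤ (prodBernoulli w).real (openConn a₂ b) + δ)
    {𝒬 : Set (Set (Sym2 V) × (Set (Sym2 V))ᵒᵈ)} (h𝒬 : IsUpperSet 𝒬) :
    (prodBernoulli w).real (openConn a₁ b ∩ {ω : BondConfig V | (openEdgeCluster ω a₂, OrderDual.toDual (openEdgeCluster ω a₁)) ∈ 𝒬}) ≤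
      (prodBernoulli w).real (openConn a₂ b ∩ {ω : BondConfig V | (openEdgeCluster ω a₂, OrderDual.toDual (openEdgeCluster ω a₁)) ∈ 𝒬}) + δ := by
  classical
  set μ := prodBernoulli w with hμ
  set X₁ : Set (BondConfig V) := openConn a₁ b with hX₁
  set X₂ : Set (BondConfig V) := openConn a₂ b with hX₂
  set Q : Set (BondConfig V) := {ω : BondConfig V | (openEdgeCluster ω a₂, OrderDual.toDual (openEdgeCluster ω a₁)) ∈ 𝒬} with hQ
  by_cases h12 : a₁ = a₂
  · subst h12
    linarith [h]
  set D : Set (BondConfig V) := {ω | ¬ (openGraph ω).Reachable a₂ a₁} with hD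
  -- on `Dᶜ` the two connection events agree
  have hagree : X₁ ∩ Dᶜ = X₂ ∩ Dᶜ := by
    ext ω
    simp only [mem_inter_iff, mem_compl_iff, mem_setOf_eq, not_not, hX₁, hX₂, hD, openConn]
    constructor
    · rintro ⟨h1, h2⟩
      exact ⟨h2.trans h1, h2⟩
    · rintro ⟨h1, h2⟩
      exact ⟨h2.symm.trans h1, h2⟩
  have hsplit : ∀ A : Set (BondConfig V), μ.real A = μ.real (A ∩ D) + μ.real (A ∩ Dᶜ) := by
    intro A
    rw [← measureReal_inter_add_sdiff (s := A) (MeasurableSet.of_discrete : MeasurableSet D), Set.sdiff_eq]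
  -- the hypothesis restricted to `D`
  have hH : μ.real (D ∩ X₁) ≤ μ.real (D ∩ X₂) + δ := by
    have h' := h
    rw [hsplit X₁, hsplit X₂, hagree] at h'
    rw [inter_comm D X₁, inter_comm D X₂]
    linarith
  -- (1) `1{a₁ ↔ b}` (increasing in `C_{a₁}`, the second cluster) is negatively correlated with `1_Q` given `D`
  have h1 := neg_corr_right w a₂ a₁ (Ne.symm h12) (isUpperSet_connFamily a₁ b) h𝒬
  rw [← openConn_eq_setOf_connFamily] at h1
  -- (3) `1{a₂ ↔ b}` (increasing in `C_{a₂}`, the first cluster) is positively correlated with `1_Q` given `D`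
  have h3 := pos_corr_left w a₂ a₁ (Ne.symm h12) (isUpperSet_connFamily a₂ b) h𝒬
  rw [← openConn_eq_setOf_connFamily] at h3
  have hQD : μ.real (D ∩ Q) ≤ μ.real D := measureReal_mono inter_subset_left
  have hcore : μ.real (X₁ ∩ Q ∩ D) ≤ μ.real (X₂ ∩ Q ∩ D) + δ := by
    rw [inter_comm (X₁ ∩ Q) D, inter_comm (X₂ ∩ Q) D]
    by_cases hD0 : μ.real D = 0
    · have h0 : μ.real (D ∩ (X₁ ∩ Q)) = 0 :=
        le_antisymm ((measureReal_mono inter_subset_left).trans hD0.le) measureReal_nonneg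
      rw [h0]
      exact add_nonneg measureReal_nonneg hδ
    · have hDpos : 0 < μ.real D := lt_of_le_of_ne measureReal_nonneg (Ne.symm hD0)
      have hchain : μ.real D * μ.real (D ∩ (X₁ ∩ Q)) ≤
          μ.real D * (μ.real (D ∩ (X₂ ∩ Q)) + δ) := by
        calc μ.real D * μ.real (D ∩ (X₁ ∩ Q))
            ≤ μ.real (D ∩ X₁) * μ.real (D ∩ Q) := h1
          _ ≤ (μ.real (D ∩ X₂) + δ) * μ.real (D ∩ Q) :=
              mul_le_mul_of_nonneg_right hH measureReal_nonneg
          _ = μ.real (D ∩ X₂) * μ.real (D ∩ Q) + δ * μ.real (D ∩ Q) := by ring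
          _ ≤ μ.real D * μ.real (D ∩ (X₂ ∩ Q)) + δ * μ.real D :=
              add_le_add h3 (mul_le_mul_of_nonneg_left hQD hδ)
          _ = μ.real D * (μ.real (D ∩ (X₂ ∩ Q)) + δ) := by ring
      exact le_of_mul_le_mul_left hchain hDpos
  have hagreeQ : X₁ ∩ Q ∩ Dᶜ = X₂ ∩ Q ∩ Dᶜ := by
    rw [inter_right_comm, hagree, inter_right_comm]
  calc μ.real (X₁ ∩ Q) = μ.real (X₁ ∩ Q ∩ D) + μ.real (X₁ ∩ Q ∩ Dᶜ) := hsplit _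
    _ ≤ μ.real (X₂ ∩ Q ∩ D) + δ + μ.real (X₂ ∩ Q ∩ Dᶜ) := by
        rw [hagreeQ]
        linarith [hcore]
    _ = μ.real (X₂ ∩ Q) + δ := by
        rw [hsplit (X₂ ∩ Q)]
        ring

/-- **Joint Lemma 3 with `δ = 0`.**  `μ(a₁ ↔ b) ≤ μ(a₂ ↔ b)` ⇒ `μ(a₁ ↔ b, Q) ≤ μ(a₂ ↔ b, Q)` for every up-down
event `Q` of `(C_{a₂}, C_{a₁})`. [cite: KozmaNitzan2024, Lemma 3 (pp. 6–7)] -/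
theorem lemma3_joint₀ (w : Sym2 V → unitInterval) (a₁ a₂ b : V)
    (h : (prodBernoulli w).real (openConn a₁ b) ≤ (prodBernoulli w).real (openConn a₂ b))
    {𝒬 : Set (Set (Sym2 V) × (Set (Sym2 V))ᵒᵈ)} (h𝒬 : IsUpperSet 𝒬) :
    (prodBernoulli w).real (openConn a₁ b ∩ {ω : BondConfig V | (openEdgeCluster ω a₂, OrderDual.toDual (openEdgeCluster ω a₁)) ∈ 𝒬}) ≤
      (prodBernoulli w).real (openConn a₂ b ∩ {ω : BondConfig V | (openEdgeCluster ω a₂, OrderDual.toDual (openEdgeCluster ω a₁)) ∈ 𝒬}) := by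
  have key := lemma3_joint w a₁ a₂ b le_rfl (by simpa using h) h𝒬
  simpa using key

omit [Fintype V] in
/-- The family behind `Q = {a₂ ↔ z₁} ∩ {a₁ ↮ z₂}` (`C_{a₂}` sees `z₁`, `C_{a₁}` does not see `z₂`) is an upper
family (increasing in `C_{a₂}`, decreasing in `C_{a₁}`). [folklore] -/
theorem isUpperSet_connNotConnFamily (a₂ z₁ a₁ z₂ : V) :
    IsUpperSet {CD : Set (Sym2 V) × (Set (Sym2 V))ᵒᵈ | CD.1 ∈ connFamily a₂ z₁ ∧ OrderDual.ofDual CD.2 ∈ disconnFamily a₁ {z₂}} := by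
  rintro ⟨C, D⟩ ⟨C', D'⟩ ⟨hCC', hDD'⟩ ⟨hC, hD⟩
  exact ⟨isUpperSet_connFamily a₂ z₁ hCC' hC,
    isLowerSet_disconnFamily a₁ {z₂} (OrderDual.toDual_le_toDual.1 hDD') hD⟩

omit [Fintype V] in
/-- `{a₂ ↔ z₁} ∩ {a₁ ↮ z₂}` is the event of that family. [folklore] -/
theorem updownEvent_connNotConnFamily (a₂ z₁ a₁ z₂ : V) :
    {ω : BondConfig V | (openEdgeCluster ω a₂, OrderDual.toDual (openEdgeCluster ω a₁)) ∈
      {CD : Set (Sym2 V) × (Set (Sym2 V))ᵒᵈ | CD.1 ∈ connFamily a₂ z₁ ∧ OrderDual.ofDual CD.2 ∈ disconnFamily a₁ {z₂}}} =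
      (openConn a₂ z₁ : Set (BondConfig V)) ∩ (openConn a₁ z₂)ᶜ := by
  ext ω
  simp only [mem_setOf_eq, mem_inter_iff, mem_compl_iff, OrderDual.ofDual_toDual]
  rw [openConn_eq_setOf_connFamily a₂ z₁]
  simp only [mem_setOf_eq, disconnFamily, mem_singleton_iff, forall_eq]
  rw [← reachable_iff_exists_mem_openEdgeCluster]
  rfl

/-- **Basic instance**: if `μ(a₁ ↔ b) ≤ μ(a₂ ↔ b)` then
`μ(a₁ ↔ b, a₂ ↔ z₁, a₁ ↮ z₂) ≤ μ(a₂ ↔ b, a₂ ↔ z₁, a₁ ↮ z₂)` for all vertices `z₁, z₂`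
(the conditioned minimality rows `H[a₀ ≤ r | r ~ z₁, a₀ !~ z₂]` of the certificates).
[cite: KozmaNitzan2024, Lemma 3 (pp. 6–7)] -/
theorem lemma3_conn_notConn (w : Sym2 V → unitInterval) (a₁ a₂ b z₁ z₂ : V)
    (h : (prodBernoulli w).real (openConn a₁ b) ≤ (prodBernoulli w).real (openConn a₂ b)) :
    (prodBernoulli w).real (openConn a₁ b ∩ (openConn a₂ z₁ ∩ (openConn a₁ z₂)ᶜ)) ≤
      (prodBernoulli w).real (openConn a₂ b ∩ (openConn a₂ z₁ ∩ (openConn a₁ z₂)ᶜ)) := by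
  have key := lemma3_joint₀ w a₁ a₂ b h (isUpperSet_connNotConnFamily a₂ z₁ a₁ z₂)
  rw [updownEvent_connNotConnFamily] at key
  exact key

end JointLemma3

end Summit.CriticalPhenomena.PercolationContinuityZ3.Theorems
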